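import Literature.AlgebraicGeometry.Resolution.AffineModelLU
import Literature.AlgebraicGeometry.Resolution.RegularLocalRingsNormal
import Mathlib.RingTheory.Localization.AsSubring
import Mathlib.RingTheory.Localization.LocalizationLocalization

/-!
# `Valuative.TorsorToLurelFfinite`: absorbing `q`-th roots into a chart (normality of the centre)

Route `ResolutionOfSingularities/Valuative`, support item `TorsorToLurelFfinite`
(stmt-ResolutionOfSingularities-0643). Helper file.

`isRegularLocalRing_centre_of_pow_mem`: let `B ⊆ T ⊆ O` be subrings of a field `K` with
`Frac B = K`, `O` a valuation ring, and suppose `B` is regular at the centre `𝔭 = 𝔪_O ∩ B` and every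
`t ∈ T` has `t^q ∈ B` for one fixed `q ≥ 1`. Then `T` is regular at its centre `𝔪_O ∩ T`, and in
fact `T_{𝔪_O ∩ T} = B_𝔭` inside `K`: the regular local ring `B_𝔭 ⊆ K` is an integrally closed
domain with fraction field `K` (Matsumura, CRT, Thm. 19.4, in-tree
`isIntegrallyClosed_of_isRegularLocalRing`), so it contains every `t ∈ T` (a root of
`X^q - t^q ∈ B[X]`), i.e. `t = a/s` with `a ∈ B`, `s ∈ B ∖ 𝔭`, and the localisation sandwich
`isRegularLocalRing_localization_of_sandwich` (in-tree) applies. This is the step "absorb the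
remaining `p`-th roots (the prescribed algebra `R` and the ground field `k`) into the chart by
normality of the regular centre" of Temkin 2013, Rem. 1.3.5 (ii).
-/

noncomputable section

set_option linter.dupNamespace false -- mandated namespace of this single-conjunct summit

open IsLocalRing
open Literature.AlgebraicGeometry.Resolution

namespace Summit.ResolutionOfSingularities.ResolutionOfSingularities.Theorems

universe u

/-- **Absorbing `q`-th roots.** `B ⊆ T ⊆ O` subrings of the field `K`, `Frac B = K`, `B` regular
at the centre of the valuation ring `O`, and `t ^ q ∈ B` for all `t ∈ T` (`q ≥ 1` fixed). Then
`T` is regular at the centre of `O` (indeed `T ⊆ B_𝔭` by normality of the regular local ring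
`B_𝔭`, whence `T_{𝔪_O ∩ T} = B_𝔭`). -/
theorem isRegularLocalRing_centre_of_pow_mem {K : Type u} [Field K] (O : ValuationSubring K)
    (B T : Subring K) (hBT : B ≤ T) [IsFractionRing B K] (hB : B ≤ O.toSubring)
    (hTO : T ≤ O.toSubring) {q : ℕ} (hq : 0 < q) (hpow : ∀ x ∈ T, x ^ q ∈ B)
    (hreg : IsRegularLocalRing (Localization.AtPrime
      (Ideal.comap (Subring.inclusion hB) (maximalIdeal O)))) :
    IsRegularLocalRing (Localization.AtPrime
      (Ideal.comap (Subring.inclusion hTO) (maximalIdeal O))) := by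
  classical
  set P' : Ideal B := Ideal.comap (Subring.inclusion hB) (maximalIdeal O) with hP'
  set P : Ideal T := Ideal.comap (Subring.inclusion hTO) (maximalIdeal O) with hP
  have hPP' : P.comap (Subring.inclusion hBT) = P' := by
    ext x
    simp only [hP, hP', Ideal.mem_comap]
    rfl
  -- the regular local ring `B_𝔭`, realised inside `K`
  let Λ : Subalgebra B K :=
    Localization.subalgebra.ofField K P'.primeCompl P'.primeCompl_le_nonZeroDivisors
  haveI : IsLocalization.AtPrime Λ P' :=
    Localization.subalgebra.isLocalization_ofField K P'.primeCompl _
  haveI : IsRegularLocalRing Λ := IsRegularLocalRing.of_ringEquiv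
    (IsLocalization.algEquiv P'.primeCompl (Localization.AtPrime P') Λ).toRingEquiv
  haveI : IsIntegrallyClosed Λ := isIntegrallyClosed_of_isRegularLocalRing Λ
  haveI : IsFractionRing Λ K :=
    IsFractionRing.isFractionRing_of_isDomain_of_isLocalization P'.primeCompl Λ K
  refine isRegularLocalRing_localization_of_sandwich hBT P P' hPP' (fun t => ?_) hreg
  -- `t` is integral over `Λ` (`t^q ∈ B ⊆ Λ`), hence lies in `Λ`
  have ht : IsIntegral Λ (t : K) := by
    refine IsIntegral.of_pow hq ?_
    have hmem : (t : K) ^ q ∈ B := hpow t t.2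
    have : (t : K) ^ q = algebraMap Λ K (algebraMap B Λ ⟨_, hmem⟩) := by
      rw [← IsScalarTower.algebraMap_apply]
      rfl
    rw [this]
    exact isIntegral_algebraMap
  obtain ⟨y, hy⟩ := IsIntegrallyClosed.algebraMap_eq_of_integral ht
  obtain ⟨a, s, hs, hy'⟩ := (mem_ofField_iff P'.primeCompl _ (y : K)).mp y.2
  have hsP' : s ∉ P' := hs
  have hs0 : (s : K) ≠ 0 := fun h0 =>
    hsP' (by rw [show s = 0 from Subtype.ext h0]; exact P'.zero_mem)
  refine ⟨a, s, fun h => hsP' ?_, ?_⟩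
  · rw [← hPP']
    exact Ideal.mem_comap.mpr h
  · have hyt : (y : K) = t := hy
    rw [← hyt, hy']
    change (a : K) * ((s : K))⁻¹ * (s : K) = (a : K)
    rw [inv_mul_cancel_right₀ hs0]

end Summit.ResolutionOfSingularities.ResolutionOfSingularities.Theorems

end
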